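import Literature.NumberTheory.CubicFields.SubringForms
import HarnessLib

/-!
# Overrings of index `p`: a cubic ring nonmaximal at `p` with content prime to `p` has an index-`p` overring (BTT Lemma 2.3 (i))

Topic `Literature/NumberTheory/CubicFields`; built on `DavenportHeilbronnMaximality.lean` (the
set `U_p`, the overrings `ofMultiple`, `ofSqDvd`), `DavenportHeilbronnMaximalityConverse.lean`
(`detOnQuot φ`, the determinant of `φ : R(f) → R(g)` on `R/ℤ`, `|detOnQuot| =` the index of
`φ(R f)` in `R(g)`) and `SubringForms.lean`.

Bhargava–Taniguchi–Thorne 2023, §2.2: "We say that a cubic form `f` is maximal at `p` if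
`f ∈ U_p`", and Lemma 2.3 (i) (from [BBP], [TT_rc]): "Let `R` be a cubic ring that is nonmaximal at
each prime divisor of `q` and whose content is coprime to `q`. Then `R` is contained in an overring
`R'` with index `q`." This file proves the case `q = p` prime (indeed any integer `p > 1`) on the
side of forms:

* `RingOfForm.detOnQuot_comp`, `detOnQuot_id`, `isUnit_detOnQuot_ringEquiv` — the index is
  multiplicative, `1` on isomorphisms;
* `RingOfForm.detOnQuot_ofSqDvd = p`, `detOnQuot_ofMultiple = p²` — the indices of the two
  Davenport–Heilbronn overrings;
* **`RingOfForm.exists_overring_index_eq`** — if `f ∉ U_p` and `f` is not a multiple of `p`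
  (content prime to `p`) then there are `g` and an injective `φ : R(f) ↪ R(g)` with `|detOnQuot φ| = p`,
  i.e. **`R(f)` is contained in an overring with index `p`** (BTT Lemma 2.3 (i), `q = p`);
* `RingOfForm.exists_overring_index_sq_of_isMultiple` — a multiple of `p` has the overring
  `R(f/p) ⊇ R(f)` of index `p²`.

-- TODO(general form): Lemma 2.3 (i) for squarefree `q` (iterate over the primes of `q`, using that
-- nonmaximality at `p' ≠ p` is preserved in an index-`p` overring) and Lemma 2.3 (ii) (the number of
-- index-`q` subrings of `R'` is at most `∏_{p ∣ q, p ∤ ct} 3 · ∏_{p ∣ q, p ∣ ct} (p + 1)`).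

## References

* M. Bhargava, T. Taniguchi, F. Thorne, *Improved error estimates for the Davenport–Heilbronn
  theorems*, Math. Ann. 389 (2024) = arXiv:2107.12819, §2.2, Lemma 2.3 (i) [BhargavaTaniguchiThorne2023].
-/

namespace Literature.NumberTheory.CubicFields

namespace RingOfForm

open BinaryCubic

variable {f g h : BinaryCubic ℤ}

/-! ### The index is multiplicative -/

/-- **`detOnQuot (ψ ∘ φ) = detOnQuot φ · detOnQuot ψ`**: the determinant on `R/ℤ·1` is
multiplicative (the matrices of `φ`, `ψ` on `(ω, θ) mod 1` multiply). [folklore] -/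
theorem detOnQuot_comp (φ : RingOfForm f →+* RingOfForm g) (ψ : RingOfForm g →+* RingOfForm h) :
    detOnQuot (ψ.comp φ) = detOnQuot φ * detOnQuot ψ := by
  simp only [detOnQuot, RingHom.comp_apply]
  rw [ringHom_apply_y ψ (φ (omega f)), ringHom_apply_z ψ (φ (omega f)), ringHom_apply_y ψ (φ (theta f)),
    ringHom_apply_z ψ (φ (theta f))]
  ring

/-- `detOnQuot id = 1`. [folklore] -/
@[simp] theorem detOnQuot_id (f : BinaryCubic ℤ) : detOnQuot (RingHom.id (RingOfForm f)) = 1 := by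
  simp [detOnQuot]

/-- An isomorphism has index `±1`. [folklore] -/
theorem isUnit_detOnQuot_ringEquiv (e : RingOfForm f ≃+* RingOfForm g) : IsUnit (detOnQuot e.toRingHom) := by
  refine IsUnit.of_mul_eq_one (detOnQuot e.symm.toRingHom) ?_
  rw [← detOnQuot_comp]
  have : e.symm.toRingHom.comp e.toRingHom = RingHom.id _ := by
    ext x <;> simp
  rw [this, detOnQuot_id]

/-- `|detOnQuot e| = 1` for an isomorphism `e`. [folklore] -/
theorem natAbs_detOnQuot_ringEquiv (e : RingOfForm f ≃+* RingOfForm g) : (detOnQuot e.toRingHom).natAbs = 1 :=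
  Int.isUnit_iff_natAbs_eq.mp (isUnit_detOnQuot_ringEquiv e)

/-! ### The indices of the Davenport–Heilbronn overrings -/

/-- **The overring `ℤ + ℤ(ω/p) + ℤθ` has index `p`**: `detOnQuot (ofSqDvd p a' b' c d) = p`. [folklore] -/
@[simp] theorem detOnQuot_ofSqDvd (p a' b' c d : ℤ) : detOnQuot (ofSqDvd p a' b' c d) = p := by
  simp [detOnQuot]

/-- **The overring `R(g) ⊇ R(p g)` has index `p²`**: `detOnQuot (ofMultiple p g) = p²`. [folklore] -/
@[simp] theorem detOnQuot_ofMultiple (p : ℤ) (g : BinaryCubic ℤ) : detOnQuot (ofMultiple p g) = p ^ 2 := by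
  simp [detOnQuot, sq]

/-! ### BTT Lemma 2.3 (i), `q = p` -/

/-- **A cubic ring nonmaximal at `p` with content prime to `p` is contained in an overring of index
`p`** (BTT 2023, Lemma 2.3 (i) for `q = p`; any integer `p > 1`): if `f ∉ U_p` and `f` is not a
multiple of `p`, then some `GL₂(ℤ)`-translate of `f` is `(p²a', pb', c, d)`, whose ring
`R(f) ≅ R((p²a', pb', c, d))` sits with index `p` in `R((a', b', c, pd)) = ℤ + ℤ(ω/p) + ℤθ`. [cite: BhargavaTaniguchiThorne2023, Lemma 2.3 (i) (nonmaximal at p, content prime to p ⇒ overring of index p)] -/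
theorem exists_overring_index_eq {p : ℕ} (hp : 1 < p) (hU : ¬ f.MemU p) (hct : ¬ f.IsMultiple p) :
    ∃ (g : BinaryCubic ℤ) (φ : RingOfForm f →+* RingOfForm g), Function.Injective φ ∧ (detOnQuot φ).natAbs = p := by
  have hp0 : (p : ℤ) ≠ 0 := by exact_mod_cast (Nat.zero_lt_one.trans hp).ne'
  -- `f ∉ U_p`, not a multiple of `p`: a translate `(p²a', pb', c, d)`
  have hex : ∃ g : BinaryCubic ℤ, GL2ZEquiv f g ∧ (p : ℤ) ^ 2 ∣ g.a ∧ (p : ℤ) ∣ g.b := by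
    by_contra h
    exact hU ⟨hct, h⟩
  obtain ⟨⟨a₁, b₁, c₁, d₁⟩, hfg, ⟨a', ha'⟩, ⟨b', hb'⟩⟩ := hex
  simp only at ha' hb'
  subst ha' hb'
  -- `R(f) ≅ R(g₁) ↪ R((a', b', c, pd))`
  obtain ⟨e⟩ := nonempty_ringEquiv_of_gl2zEquiv hfg
  refine ⟨⟨a', b', c₁, p * d₁⟩, (ofSqDvd p a' b' c₁ d₁).comp e.symm.toRingHom,
    (ofSqDvd_injective hp0 a' b' c₁ d₁).comp e.symm.injective, ?_⟩
  rw [detOnQuot_comp, Int.natAbs_mul, natAbs_detOnQuot_ringEquiv, detOnQuot_ofSqDvd, one_mul, Int.natAbs_natCast]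

/-- The discriminant drops by `p²`: in the situation of `exists_overring_index_eq`,
`Disc f = p² · Disc g`. [folklore] -/
theorem exists_overring_disc_eq {p : ℕ} (hp : 1 < p) (hU : ¬ f.MemU p) (hct : ¬ f.IsMultiple p) :
    ∃ (g : BinaryCubic ℤ) (φ : RingOfForm f →+* RingOfForm g), Function.Injective φ ∧ f.disc = (p : ℤ) ^ 2 * g.disc := by
  obtain ⟨g, φ, hφ, hdet⟩ := exists_overring_index_eq hp hU hct
  refine ⟨g, φ, hφ, ?_⟩
  rw [disc_eq_detOnQuot_sq_mul φ hφ, ← Int.natAbs_sq (detOnQuot φ), hdet]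

/-- **A multiple of `p` has an overring of index `p²`**: `R(p g) = ℤ + p R(g) ⊆ R(g)`
(the content; BTT §2.2). [cite: BhargavaTaniguchiThorne2023, §2.2 (content: R = ℤ + nR')] -/
theorem exists_overring_index_sq_of_isMultiple {p : ℕ} (hp : 1 < p) (hm : f.IsMultiple p) :
    ∃ (g : BinaryCubic ℤ) (φ : RingOfForm f →+* RingOfForm g), Function.Injective φ ∧ (detOnQuot φ).natAbs = p ^ 2 := by
  have hp0 : (p : ℤ) ≠ 0 := by exact_mod_cast (Nat.zero_lt_one.trans hp).ne'
  obtain ⟨g, rfl⟩ := isMultiple_iff_exists_smul.mp hm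
  refine ⟨g, ofMultiple p g, ofMultiple_injective hp0 g, ?_⟩
  rw [detOnQuot_ofMultiple, Int.natAbs_pow, Int.natAbs_natCast]

/-- Conversely to Prop. 2.2 at one prime: **if `f ∉ U_p` then `R(f)` has a proper overring whose
index is `p` or `p²`** — in particular `R(f)` is not maximal (`not_isMaximal_of_not_memU`). [folklore] -/
theorem exists_overring_of_not_memU {p : ℕ} (hp : 1 < p) (hU : ¬ f.MemU p) :
    ∃ (g : BinaryCubic ℤ) (φ : RingOfForm f →+* RingOfForm g), Function.Injective φ ∧
      ((detOnQuot φ).natAbs = p ∨ (detOnQuot φ).natAbs = p ^ 2) := by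
  by_cases hm : f.IsMultiple p
  · obtain ⟨g, φ, hφ, h⟩ := exists_overring_index_sq_of_isMultiple hp hm
    exact ⟨g, φ, hφ, Or.inr h⟩
  · obtain ⟨g, φ, hφ, h⟩ := exists_overring_index_eq hp hU hm
    exact ⟨g, φ, hφ, Or.inl h⟩

end RingOfForm

end Literature.NumberTheory.CubicFields
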